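import Literature.MathematicalPhysics.QuantumFieldTheory.Balaban1983to89.Beta.Composition

/-!
# `Balaban1983to89.Beta.KKTSplit` — β sub-cell (lead, BETA-SPEC.md v1.3 §8): the bordered determinant of a constrained
quadratic form is unchanged by adding `Qᵀ A Q`, and the resulting UV/IR split of `log Z` at the REGULARISED form
`K = H + Qᵀ A Q` — kernel-checked finite-dimensional algebra, no facts

HONEST FRAMING (cell rule, verbatim): discharging `BetaPertH` makes Bałaban's UV stability UNCONDITIONAL — a real
constructive-QFT result; it is NOT the continuum limit and NOT the Clay problem.  THIS MODULE DISCHARGES NOTHING of the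
series: two identities of matrix algebra over a field (logarithmic form over `ℝ`), used by the cell file
`HOME/BETA-SPEC.md` §8 to organise the located one-loop estimate.  Value = kernel identity, NOT summit progress (audit
cell `pub-balaban`, unit `b2b-balaban-strat-b12`, journal node BETA-KKTSPLIT-KERNEL).

CITATION HEADER (lean-in-tree rule 2026-08-18).  Sources (read by the cell on the x2 page renders; this file quotes only
what fixes WHICH operators the identity is meant for, and asserts nothing about them):
T. Bałaban, *Propagators for lattice gauge theories in a background field*, Commun. Math. Phys. **99**, 389–434 (1985)
[Balaban1985BackgroundPropagators] (cell paper B9), p. 420 (3.122): "G⁻¹ defined as G⁻¹ = Δ_π + DRD* + Q*aQ" — the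
fine-lattice fluctuation form PLUS the averaging term `Q*aQ`, the operator whose inverse `G` carries the series' printed
η-uniform bounds; T. Bałaban, *Renormalization group approach to lattice gauge field theories. I*, Commun. Math. Phys.
**109**, 249–301 (1987) [Balaban1987RG1] (B12), (1.4) p. 260: "Z^{(j)}(U_k) = ∫ dB δ(Q̃B) exp[−½⟨B, Δ^{(j)}(U_k)B⟩]" — the
δ-constrained Gaussian normalisation whose closed form is the bordered determinant (cell modules `Beta/OneLoop.lean`,
`Beta/Composition.lean`; the Gaussian evaluation itself is the cell obligation C-beta-6, modules `Beta/GaussianIntegral`,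
`Beta/ConstraintElimination`).

WHAT IS PROVED (over the bordered matrix `Composition.kkt H Q = [[H, Qᵀ],[Q, 0]]` of the sibling module, which this file
imports and does not restate):
* `kkt_add_conj_eq`: `kkt (H + Qᵀ A Q) Q = [[1, Qᵀ A],[0, 1]] * kkt H Q` and hence `det_kkt_add_conj`:
  `det kkt (H + Qᵀ A Q) Q = det kkt H Q` for EVERY square `A` — on the constraint surface `Qx = 0` the term `Qᵀ A Q`
  is invisible, and the closed form sees exactly that;  `logZ_add_conj`: `logZ (H + QᵀAQ) Q = logZ H Q`.
* `abs_det_kkt_eq_of_reg` / `logZ_split_reg`: if the REGULARISED form `K := H + Qᵀ A Q` is invertible, then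
  `|det kkt H Q| = |det K| · |det (Q K⁻¹ Qᵀ)|` and
  `logZ H Q = ((|ν| − |μ|)/2) log 2π − ½ log|det K| − ½ log|det (Q K⁻¹ Qᵀ)|`
  — the split of the cell's row an3 (`Beta/Transfer.logZ_split`, which assumes `H` itself invertible) moved to the
  regularised operator, so that NO invertibility or mass term is required of `H`: in [Balaban1985BackgroundPropagators]'s
  setting `K⁻¹ = G` of (3.122) and `Q K⁻¹ Qᵀ = QGQ*` of (3.126).  Which concrete operators enter, and every analytic
  statement about them, is OUTSIDE this file (cell rows an1/an2/an3; BETA-SPEC §8 (H1)/(H2) are HYPOTHESES there).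
No `def … : Prop` is introduced (D-0026).  Mathlib + `Beta.Composition` only; no `sorry`/`axiom`.
-/

namespace Literature.MathematicalPhysics.QuantumFieldTheory.Balaban1983to89.Beta.KKTSplit

open Literature.MathematicalPhysics.QuantumFieldTheory.Balaban1983to89.Beta.Composition
open scoped Matrix

section Field

variable {𝕜 : Type*} [Field 𝕜]
variable {ν μ : Type*} [Fintype ν] [Fintype μ] [DecidableEq ν] [DecidableEq μ]

/-- The unimodular block "row operation" `[[1, Qᵀ A],[0, 1]]`. [folklore] -/
def rowOp (Q : Matrix μ ν 𝕜) (A : Matrix μ μ 𝕜) : Matrix (ν ⊕ μ) (ν ⊕ μ) 𝕜 :=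
  Matrix.fromBlocks 1 (Qᵀ * A) 0 1

/-- `det [[1, QᵀA],[0, 1]] = 1`. [folklore] -/
theorem det_rowOp (Q : Matrix μ ν 𝕜) (A : Matrix μ μ 𝕜) : (rowOp Q A).det = 1 := by
  unfold rowOp
  rw [Matrix.det_fromBlocks_zero₂₁, Matrix.det_one, Matrix.det_one, mul_one]

/-- Adding `Qᵀ A Q` to the form is the row operation: `kkt (H + QᵀAQ) Q = [[1, QᵀA],[0,1]] · kkt H Q`. [folklore] -/
theorem kkt_add_conj_eq (H : Matrix ν ν 𝕜) (Q : Matrix μ ν 𝕜) (A : Matrix μ μ 𝕜) :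
    kkt (H + Qᵀ * A * Q) Q = rowOp Q A * kkt H Q := by
  unfold kkt rowOp
  rw [Matrix.fromBlocks_multiply]
  congr 1
  · rw [Matrix.one_mul, Matrix.mul_assoc]
  · rw [Matrix.one_mul, Matrix.mul_zero, add_zero]
  · rw [Matrix.zero_mul, Matrix.one_mul, zero_add]
  · rw [Matrix.zero_mul, Matrix.one_mul, zero_add]

/-- **a-independence of the bordered determinant**: `det kkt (H + Qᵀ A Q) Q = det kkt H Q` for every square `A`
(in [Balaban1985BackgroundPropagators] (3.122) the term is `Q*aQ`, `A = a·1`). [folklore] -/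
theorem det_kkt_add_conj (H : Matrix ν ν 𝕜) (Q : Matrix μ ν 𝕜) (A : Matrix μ μ 𝕜) :
    (kkt (H + Qᵀ * A * Q) Q).det = (kkt H Q).det := by
  rw [kkt_add_conj_eq, Matrix.det_mul, det_rowOp, one_mul]

/-- The same with the sibling module's `compForm H Q A = H + Qᵀ A Q`. [folklore] -/
theorem det_kkt_compForm_self (H : Matrix ν ν 𝕜) (Q : Matrix μ ν 𝕜) (A : Matrix μ μ 𝕜) :
    (kkt (compForm H Q A) Q).det = (kkt H Q).det :=
  det_kkt_add_conj H Q A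

/-- **The determinant split at the regularised form**: if `K := H + Qᵀ A Q` is invertible then
`det kkt H Q = det K · det(−Q K⁻¹ Qᵀ)` — `H` itself need not be invertible. [folklore] -/
theorem det_kkt_eq_of_reg (H : Matrix ν ν 𝕜) (Q : Matrix μ ν 𝕜) (A : Matrix μ μ 𝕜)
    (hK : IsUnit (H + Qᵀ * A * Q).det) :
    (kkt H Q).det = (H + Qᵀ * A * Q).det * (-blockProp (H + Qᵀ * A * Q) Q).det := by
  rw [← det_kkt_add_conj H Q A, det_kkt _ Q hK]

end Field

section Real

variable {ν μ : Type*} [Fintype ν] [Fintype μ] [DecidableEq ν] [DecidableEq μ]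

/-- `logZ` is unchanged by adding `Qᵀ A Q` to the form (the constrained Gaussian only sees `H` on `ker Q`). [folklore] -/
theorem logZ_add_conj (H : Matrix ν ν ℝ) (Q : Matrix μ ν ℝ) (A : Matrix μ μ ℝ) :
    logZ (H + Qᵀ * A * Q) Q = logZ H Q := by
  unfold logZ
  rw [det_kkt_add_conj]

/-- Absolute-value form of the split at the regularised form `K = H + QᵀAQ` (invertible):
`|det kkt H Q| = |det K| · |det (Q K⁻¹ Qᵀ)|`. [folklore] -/
theorem abs_det_kkt_eq_of_reg (H : Matrix ν ν ℝ) (Q : Matrix μ ν ℝ) (A : Matrix μ μ ℝ)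
    (hK : IsUnit (H + Qᵀ * A * Q).det) :
    |(kkt H Q).det| = |(H + Qᵀ * A * Q).det| * |(blockProp (H + Qᵀ * A * Q) Q).det| := by
  rw [det_kkt_eq_of_reg H Q A hK, abs_mul, Matrix.det_neg, abs_mul, abs_pow, abs_neg, abs_one, one_pow, one_mul]

/-- **The UV/IR split of `log Z` at the regularised form** (cell BETA-SPEC §8 (S)): for `K := H + Qᵀ A Q` invertible and
the block propagator `Q K⁻¹ Qᵀ` invertible,
`logZ H Q = ((|ν| − |μ|)/2)·log 2π − ½·log|det K| − ½·log|det (Q K⁻¹ Qᵀ)|` — the "bulk" determinant of the regularised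
fine form and the "unit" determinant of the block propagator; no hypothesis on `H` alone. [folklore] -/
theorem logZ_split_reg (H : Matrix ν ν ℝ) (Q : Matrix μ ν ℝ) (A : Matrix μ μ ℝ)
    (hK : IsUnit (H + Qᵀ * A * Q).det) (hP : IsUnit (blockProp (H + Qᵀ * A * Q) Q).det) :
    logZ H Q = ((Fintype.card ν : ℝ) - Fintype.card μ) / 2 * Real.log (2 * Real.pi)
      - (1 / 2 : ℝ) * Real.log |(H + Qᵀ * A * Q).det|
      - (1 / 2 : ℝ) * Real.log |(blockProp (H + Qᵀ * A * Q) Q).det| := by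
  unfold logZ
  rw [abs_det_kkt_eq_of_reg H Q A hK,
    Real.log_mul (abs_ne_zero.mpr hK.ne_zero) (abs_ne_zero.mpr hP.ne_zero)]
  ring

/-- Under the same hypotheses the bordered determinant is non-zero (so `logZ H Q` is not a junk value). [folklore] -/
theorem det_kkt_ne_zero_of_reg (H : Matrix ν ν ℝ) (Q : Matrix μ ν ℝ) (A : Matrix μ μ ℝ)
    (hK : IsUnit (H + Qᵀ * A * Q).det) (hP : IsUnit (blockProp (H + Qᵀ * A * Q) Q).det) :
    (kkt H Q).det ≠ 0 := by
  rw [← det_kkt_add_conj H Q A]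
  exact det_kkt_ne_zero _ Q hK hP

end Real

end Literature.MathematicalPhysics.QuantumFieldTheory.Balaban1983to89.Beta.KKTSplit
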